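import Mathlib
import HarnessLib
import HarnessLib.Audit
import Summits.QuantumAdvantage.Statement
import Summits.QuantumAdvantage.QuantumAdvantage.Theorems.StabilizerDialGauge
import Summits.QuantumAdvantage.QuantumAdvantage.Theses.HolonomyDial
import HarnessLib.Audit.Status.Attr

/-!
Route: StabilizerDial

# Route StabilizerDial — StabilizerDial — cut the junction PolyLossOddU3 (26531 = HolonomyDial
residual AvoidLift3, 34246) by the GAUGE-SATURATED locus dichotomy: FewLocusLoss3 (crux) and
StabGenericLossPos3 (residual)

CHILD route (D-0170 `refines route-QuantumAdvantage-HolonomyDial:AvoidLift3`, item 34246 — the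
lens-2 lineage's declared residual `AvoidLift3 := HolAvoidLoss3 → PolyLossOddU3`, which IS the
junction 26531 since `HolAvoidLoss3` (34245) is proved: landed
`Theorems.HolonomyDial.polyLossOddU3_iff_avoidLift3`; the gate refuses `refines
ExactnessDial:PolyLossOddU3` because 26531 is kind target there — rung currency F-Q1-p3; cell
decomp-qadv, lens-2 g16 «LocusDial» → g17 «StabilizerDial» rev 2, critic rows 69v16–69v21, CLEARED
69v21 2026-08-30T23:30Z once the gating theorem `antipodalGenericPos3` was sorry-free). It suffices
to show X = FewLocusLoss3 ∧ StabGenericLossPos3, the two halves of an EXACT cut of the junction T =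
PolyLossOddU3 (26531) (every polylog-degree 𝔽₃ strategy loses an inverse-polynomial fraction of the
ODD class of the n-cycle hidden-linear-function ring game): U = FewLocusLoss3 is T restricted to
strategies whose deviation set from the canonical guess is, for all but a 1/log₂ n fraction of odd
inputs, covered by m windows of width r (locations arbitrary and input-dependent); G =
StabGenericLossPos3 is T restricted to the GENERIC class — strategies that NO stabilizer gauge of
degree (log₂ n)^(c+1) turns into an (m+1, r)-few-locus strategy. The node equation `nodePos_iff : T
↔ U ∧ G` is a landed theorem (Theorems.StabilizerDial, GaugeZ), so the deciding theorem concludes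
the parent item BY NAME: closes (hU : FewLocusLoss3) (hG : StabGenericLossPos3) (g : StabSplitGlue3)
: HolonomyDial.AvoidLift3 := fun _ => g hU hG, with the support binder g := U → G →
ExactnessDial.PolyLossOddU3 (26531) inhabited now by `polyLossOddU3_of_stabPos` (sketch rc 0:
`closes`, `closes_junction : … → ExactnessDial.PolyLossOddU3`, `parent_residual_iff_junction :
HolonomyDial.AvoidLift3 ↔ ExactnessDial.PolyLossOddU3`).
Lean: `(∃ C : ℕ, ∀ m r c : ℕ, ∃ n₀ : ℕ, ∀ n ≥ n₀, ∀ P : Fin n →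
Literature.Computability.MetaComplexity.Smolensky.CubeFn (ZMod 3) n, (∀ i, P i ∈
Literature.Computability.MetaComplexity.Smolensky.lowDeg (ZMod 3) n ((Nat.log 2 n) ^ c)) →
Summit.QuantumAdvantage.QuantumAdvantage.Theorems.LocusDial.FewLocus m r P → ((Finset.univ.filter
fun x : Fin n → Bool => Summit.QuantumAdvantage.AdviceFreeQNC0.OddZeros x ∧
Literature.Computability.QuantumComplexity.RingHLF.Rel x (fun i => decide (P i x = 1))).card : ℝ) ≤
(1 - 1 / (n : ℝ) ^ C) * (2 : ℝ) ^ (n - 1)) ∧ (∃ C : ℕ, ∀ m r c : ℕ, ∃ n₀ : ℕ, ∀ n ≥ n₀, ∀ P : Fin n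
→ Literature.Computability.MetaComplexity.Smolensky.CubeFn (ZMod 3) n, (∀ i, P i ∈
Literature.Computability.MetaComplexity.Smolensky.lowDeg (ZMod 3) n ((Nat.log 2 n) ^ c)) → ¬
Summit.QuantumAdvantage.QuantumAdvantage.Theorems.StabilizerDial.StabFew (m + 1) r (c + 1) P →
((Finset.univ.filter fun x : Fin n → Bool => Summit.QuantumAdvantage.AdviceFreeQNC0.OddZeros x ∧
Literature.Computability.QuantumComplexity.RingHLF.Rel x (fun i => decide (P i x = 1))).card : ℝ) ≤
(1 - 1 / (n : ℝ) ^ C) * (2 : ℝ) ^ (n - 1))`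

## Assembly
Pure logic on top of the landed node equation: closes (hU : FewLocusLoss3) (hG :
StabGenericLossPos3) (g : StabSplitGlue3) :
Summit.QuantumAdvantage.QuantumAdvantage.Theses.HolonomyDial.AvoidLift3 := fun _ => g hU hG (3
load-bearing binders, 0 sorry; `HolonomyDial.PolyLossOddU3` and `ExactnessDial.PolyLossOddU3` are
the same text, item 26531); upstream, HolonomyDial's `closes (hA : HolAvoidLoss3) (hL : AvoidLift3)
(hD : DPLift3) : AdviceFreeQNC0Three` (34245 PROVED) and `Theorems.StabilizerDial.closesPos : U → G
→ ExactnessDial.DPLift3 → AdviceFreeQNC0Three` carry it to the rung leaf F-Q1-p3.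

REFINES route-QuantumAdvantage-HolonomyDial:AvoidLift3 (edge split, depth 1; chain
route-QuantumAdvantage-HolonomyDial › route-QuantumAdvantage-StabilizerDial) — the deciding theorem
of this CHILD route concludes the parent piece
`Summit.QuantumAdvantage.QuantumAdvantage.Theses.HolonomyDial.AvoidLift3` BY NAME (imported from
Summits.QuantumAdvantage.QuantumAdvantage.Theses.HolonomyDial); closing this route proves that piece
of the parent, never the summit Statement (D-0170).

Rationale: WHY THIS LINE. The output side of the ring game has a symmetry nobody had typed: on every odd input
x the game matrix M(x) = A_C_n + diag(x) over 𝔽₂ is symmetric with a kernel LINE, so XOR-ing any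
answer with a row combination M(x)β(x) preserves winning (`rel_rowPad_iff`, BravyiGossetKonig2018
§4.1 orthogonality criterion made input-uniform); at polynomial level the pads `pad P s` cost degree
2D + 6E + 1 and move the deviation set by the row set of s (`dev_pad`). Lens-2 g16 cut T by the
covering geometry of the deviation set (few-locus / many-locus) and the critic (69v16) collapsed the
many-locus half to T by ROW PADDING — now the landed theorem `manyLocusLoss3_iff`; g17 answers one
level up by SATURATING the special class under all polylog-degree gauges (`StabFew m r e`), takes G
on the complement with the gauge budget one notch above the strategy's degree so that the generic
class is padding-closed BY THEOREM (`generic_pad_of_generic`, `generic_of_generic_pad`), and removes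
the zero-window corner that made the rev-1 G ≡ T (`stabGenericLoss3_iff`, negative knowledge #2) by
counting windows from one; non-emptiness of the generic class at every (m+1, r, c ≥ 1) is now the
sorry-free tree theorem `antipodal_class_nonempty` (antipodal family t_j ⊕ [x_(j+⌊n/2⌋)], odd-slice
Smolensky estimate + block averaging), which is what fired the critic's revisit rule. Imported
areas: Razborov–Smolensky correlation bounds for 𝔽₃ polynomials vs parity (Smolensky1987,
[corpus:book:jukna2012-boolean-function-complexity-advances-frontiers pp.364–366]), programs over
solvable groups / width-3 permutation automata for the kernel phase walk
(BarringtonStraubingTherien1990), the HLF relation games (BravyiGossetKonig2018, arXiv:1906.08890).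
What no prior route does: ScaleDial (loss scale of 26533), CodimDial/SpreadDial (covers /
codimension of 30910), HolonomyDial/AnchorDial (declared anchors, holonomy), GaugeDial (INPUT-side
flip gauge), AbsorptionDial (walk game degree axis) never use the OUTPUT gauge; this is the first
cut of 26531 by a gauge-invariant property of the bet, with the collapse mechanism of its
predecessor turned into a theorem that certifies the new cut.

RANKED CRUXES. #2 FewLocusLoss3 (crux) — U — LOCALISATION (leaf ATTACKABLE; text = the landed
`Theorems.LocusDial.FewLocusLoss3` verbatim): for some C, for all m, r, c, eventually in n, every 𝔽₃
strategy of output degree (log₂ n)^c whose deviation set from the canonical guess is (m,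
r)-coverable on all but a 2^(n−1)/log₂ n part of the odd class wins at most (1 − n^(−C))·2^(n−1) odd
inputs of the n-cycle ring game. T-implied by restriction (`fewLocusLoss3_of_polyLossOddU3`); attack
of record through the pointer leaves `FreePointerLoss3 → AffinePointerLoss3` (tree
`LocusDialPointer`), rung `blindPointer_loss` PROVED (`LocusDialRung`). [difficulty: L] (why it
might fail: one-window POINTER bets win 2/3 already; a degree-(log₂ n)^c pointer family that reads
the kernel PHASE walk of the ring (width-3 permutation automaton, solvable S₄) could place its
single deviation correctly on a 1 − n^(−ω(1)) fraction of the odd class — AffinePointerLoss3 is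
open.) [BravyiGossetKonig2018, arXiv:1906.08890, BarringtonStraubingTherien1990, Smolensky1987]
#3 StabGenericLossPos3 (crux) — G — the GENERIC piece (declared RESIDUAL of this cut; leaf
IDEA-NEEDED; text = the landed `Theorems.StabilizerDial.StabGenericLossPos3` verbatim): for some C,
for all m, r, c, eventually in n, every 𝔽₃ strategy of output degree (log₂ n)^c that NO stabilizer
gauge s of degree (log₂ n)^(c+1) turns into an (m+1, r)-few-locus strategy (¬ StabFew (m+1) r (c+1)
P) wins at most (1 − n^(−C))·2^(n−1) odd inputs. T-implied by restriction; ≡ T modulo U like every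
complement piece (`nodePos_iff`), but padding-closed by theorem and with a certified non-empty class
at every (m+1, r, c ≥ 1) (`antipodal_class_nonempty`). [difficulty: open-problem] (why it might
fail: a «dark» win-preserving XOR map w (low degree, w(x) ∈ Im M(x) a.e., quotient M(x)⁺w NOT
polylog-degree) would move near-perfect structured strategies into the generic class, so G carries
all of T with no reduction; null-answer rigidity is only instrument-checked (n ≤ 12).)
[BravyiGossetKonig2018, arXiv:1906.08890, Smolensky1987, BarringtonStraubingTherien1990]
#9 StabSplitGlue3 (support) — the split glue: U and G give the parent item 26531 (dichotomy at
budget c on `StabFew (c+1) c (c+1) P`: structured ⇒ U at (c+1, c, c+2) applied to the pad, win set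
unchanged by `winset_pad`; generic ⇒ G at (c, c, c); C := max). A binder of `closes` so that the
refined target is in the cone BY NAME; inhabited NOW by the landed
`Theorems.StabilizerDial.polyLossOddU3_of_stabPos` (census-closable at birth). [difficulty:
provable-now] [BravyiGossetKonig2018]

TWO-LAYER PLAN. Foreseen, NOT filed now: U ⇐ FreePointerLoss3 → (FewLocusLoss3 from the pointer
leaves via the landed strip decomposition `fewLocusLoss3_iff_strip : U ↔ MultiAnchorLoss3 ∧
FreeLocusLoss3`) with `AffinePointerLoss3` as the first attackable leaf (transfer-operator bound in
W-coordinates); G ⇐ its strong constant-loss form `StabGenericConstPos3 → G` (landed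
`stabGenericLossPos3_of_constPos`) once an idea for decorrelating gauge-irreducible multi-locus bets
exists. Both are layer-2 `--split`s of this route later; no third layer.

KILL CRITERIA. A refutation of FewLocusLoss3 (a polylog-degree few-locus family — necessarily
pointer-like — winning a 1 − n^(−ω(1)) fraction of the odd class) closes the route
`refuted:FewLocusLoss3` AND refutes the parent junction 26531 and T = RingHardOdd 3 (U is
T-implied): informative either way. A refutation of StabGenericLossPos3 likewise refutes 26531. A
proof of 26531 or of RingHardOdd 3 elsewhere moots the route (superseded). A proof of U alone
re-targets the residual G (≡ T mod U) and the strong form StabGenericConstPos3 / the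
null-answer-rigidity question become the next edit; a proved «dark symmetry» w (non-gauge universal
null answer of polylog degree) forces a pivot: re-saturate the structured class under w.

NOT DECOMPOSED YET. The pointer leaves of U (FreePointerLoss3, AffinePointerLoss3 — tree defs in
LocusDialPointer) and the constant-loss strengthening of G are deliberately not items at open
(two-layer cap; they wait for a crux seat's registered line); the gauge level offset (c+1 for degree
exponent c), the window count from one (m+1) and the a.e. threshold 1/log₂ n are fixed inside the
landed definitions and are not parameters of the route; the witness families (antipodal `apStrat`,
`acStrat`, comb pads) are certificates, not items; the outer lift DPLift3 (26124) stays the parent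
route's item.

CHEAPEST FALSIFIER. The ∀-parameter CORNER TEST and the ROW-PADDING TEST (critic standing guards
69v16/69v17b), both already run in the kernel: rev-1 G at m = 0 collapsed to T
(`stabGenericLoss3_iff`) and g16's many-locus piece collapsed by the comb pad (`manyLocusLoss3_iff`)
— the filed G counts windows from one and is padding-closed by `generic_of_generic_pad`; lens probes
Q1–Q11 (15 must-fail) and the critic's AP/APZ checks found no cheap collapse of U or G; the writer's
BC2/BC7 batteries repeat this on the route texts. Next cheapest: exhibit ONE polylog-degree strategy
family provably outside both U's class and G's reach with win rate 1 − o(1) (none is known; pointer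
bets sit at 2/3).

NUMBERS. Pad degree 2·D + 6·E + 1 (`pad_mem`); dichotomy instantiated at (m, r, e) = (c+1, c, c+1)
with pad degree ≤ (log₂ n)^(c+2) for n ≥ 512 (`deg_pad_stab`); coverable sets have ≤ m(r+1) elements
(`Coverable.card_le`); antipodal witness generic at every (m+1, r, c ≥ 1) for k ≥ 3456·(8(log₂ n)^e
+ 1)² (tree `StabilizerDialAntipodal`); pointer value 2/3 (`blindPointer_loss`); known regime of T:
output degree ≤ 1 only (`AffBells37.affBellsPolyLoss3`, junta transfer needs d + 2 ≤ p).

DEFINITION REQUESTS. None: `FewLocus`, `Coverable`, `dev`, `StabFew`, `pad` are landed Theorems-side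
definitions (LocusDialPieces, AnchorDialMulti, StabilizerDialGaugeA/Gauge), referenced by qualified
name; the route imports `Summits.QuantumAdvantage.QuantumAdvantage.Theorems.StabilizerDialGauge`
(transitively LocusDialPieces; no Theses module other than the parent's cone: ExactnessDial,
ProductDial, SpreadDial, PencilDial, FormsDichotomy, RingFrame via MultiRingBridge/RingFrameBridge —
no cycle).

Novelty: Searches (2026-08-30, writer g7; lens-2 g17 searches in NODE-g17 §Why novel): `lit search --hybrid
"hidden linear function relation problem classical lower bound low-degree polynomials mod 3 parity"
-n 8` (8 docs; [corpus:book:jukna2012-boolean-function-complexity-advances-frontiers pp.364–366]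
Smolensky/Razborov approximation by 𝔽₃ polynomials;
[corpus:book:arora2009-computational-complexity-modern-approach p.359]; rest noise); `lit vsearch
"<the dichotomy in prose>" -k 6` (noise only: games/automata proceedings — null); `lit galaxy search
"hidden linear function|2D HLF|Bravyi-Gosset-K" --star pdf -n 8` (8 hits, one relevant:
[galaxy:pdf:-2756880049553291600] Grewal–Kumar, ECCC 2024/130, improved circuit lower bounds and
exponential quantum–classical separations — parity/correlation technology against AC⁰[p]-type
classes, no gauge dichotomy of strategies); `lit galaxy search "programs over solvable
groups|width-3 permutation branching|MOD3 versus parity" --star pdf -n 8` (2 hits: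
[galaxy:pdf:-260030134040235020] Reingold–Steinke–Vadhan, pseudorandomness for regular branching
programs — distant); tree `rg "StabFew|rowPad|pad P s|gauge" Summits/QuantumAdvantage` = only this
lineage's landed parts and GaugeDial's INPUT-side flip gauge (different object).
Nearest prior art found: BravyiGossetKonig2018 §4.1 / `Literature…NoisyRingHLF.rel_bxor_iff` (given
a valid z, Rel x (z ⊕ e) ↔ e ⟂ K(x): the orthogonality CRITERION) and `Theorems/RingDeck.rel_xor3`
(affine structure of the ans  [refs: book:jukna2012-boolean-function-complexity-advances-frontiers, book:arora2009-computational-complexity-modern-approach, BravyiGossetKonig2018]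

Barriers (technique_class: decomposition, gauge saturation, correlation bounds): - technique_class: decomposition, gauge saturation, correlation bounds
- Literature.Barriers.QuantumAdvantage.NonclassicalDegreeLogBarrier: U and G are correlation-type
bounds for polylog-degree 𝔽₃ polynomials against the ring RELATION restricted to a class of bets —
inside the general low-degree-correlation family the barrier speaks to, but neither requires beating
it head-on as typed: they are restrictions of the already-filed 26531 and inherit its placement (the
barrier caps pointwise correlation with a Boolean function at degree ≥ log n,
[galaxy:pdf:6032370442476464720]; the odd-class relation game is not a Boolean function and U's
attack goes through the kernel phase walk / pointer transfer operator, G's through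
gauge-irreducibility); honest residue: a proof of G by a pointwise Smolensky bound at degree (log
n)^c would re-enter the class.
- Literature.Barriers.QuantumAdvantage.TwoModuliDepthTwo: inside the two-moduli shadow exactly as
the parent 26531 (parities of 𝔽₃-polynomial bits against one 𝔽₂ relation); the ROW-PADDING barrier
of this lineage (landed `manyLocusLoss3_iff`, `stabGenericLoss3_iff`) is the one that bites
dichotomies of 26531 and G is placed OUTSIDE it by theorem (`generic_of_generic_pad`);
[corpus:book:jukna2012-boolean-function-complexity-advances-frontiers p.368] «much less is known …
composite» is the ceiling the line stays under.
- Literature.Barriers.QuantumAdvantage.NaturalProofs: inside-and-unobstructed — lower bounds against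
polylog-degree 𝔽₃ po

sub-problem: QuantumAdvantage · status: draft · opened planner-decomp-qadv-writer-1-g7-0 2026-08-30T23:57:54Z · rev 0 · ledger route-QuantumAdvantage-StabilizerDial
GENERATED by the gate from the ledger (D-0016/17). Provers cite these decls: `theorem foo : Summit.QuantumAdvantage.QuantumAdvantage.Theses.StabilizerDial.<Decl> := …` in Summits/QuantumAdvantage/QuantumAdvantage/Theorems/<Name>.lean.
-/

namespace Summit.QuantumAdvantage.QuantumAdvantage.Theses.StabilizerDial

open scoped BigOperators Topology Manifold Classical MeasureTheory ProbabilityTheory Matrix InnerProductSpace ComplexConjugate ContinuousMap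
open Filter Set Function TopologicalSpace MeasureTheory

attribute [summit_statement] _root_.QuantumAdvantage
attribute [summit_statement] _root_.Summit.QuantumAdvantage.QuantumAdvantage.Theses.HolonomyDial.AvoidLift3

open Literature.QuantumAdvantage

/-- item stmt-QuantumAdvantage-27137 · crux · leaf ATTACKABLE · rank 2 · open · by planner
why it might fail: one-window POINTER bets win 2/3 already; a degree-(log₂ n)^c pointer family that reads the kernel PHASE walk of the ring (width-3 permutation automaton, solvable S₄) could place its single deviation correctly on a 1 − n^(−ω(1)) fraction of the odd class — AffinePointerLoss3 is open.
sources: BravyiGossetKonig2018, arXiv:1906.08890, BarringtonStraubingTherien1990, Smolensky1987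
[crux] U — LOCALISATION (leaf ATTACKABLE; text = the landed `Theorems.LocusDial.FewLocusLoss3`
verbatim): for some C, for all m, r, c, eventually in n, every 𝔽₃ strategy of output degree (log₂
n)^c whose deviation set from the canonical guess is (m, r)-coverable on all but a 2^(n−1)/log₂ n
part of the odd class wins at most (1 − n^(−C))·2^(n−1) odd inputs of the n-cycle ring game.
T-implied by restriction (`fewLocusLoss3_of_polyLossOddU3`); attack of record through the pointer
leaves `FreePointerLoss3 → AffinePointerLoss3` (tree `LocusDialPointer`), rung `blindPointer_loss`
PROVED (`LocusDialRung`). [difficulty: L] -/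
@[route_item "route-QuantumAdvantage-StabilizerDial", crux (bottleneck := work) (source := "ledger D-0171 leaf tag ATTACKABLE on stmt-QuantumAdvantage-27137, 2026-09-01")]
def FewLocusLoss3 : Prop :=
  ∃ C : ℕ, ∀ m r c : ℕ, ∃ n₀ : ℕ, ∀ n ≥ n₀, ∀ P : Fin n → Literature.Computability.MetaComplexity.Smolensky.CubeFn (ZMod 3) n, (∀ i, P i ∈ Literature.Computability.MetaComplexity.Smolensky.lowDeg (ZMod 3) n ((Nat.log 2 n) ^ c)) → Summit.QuantumAdvantage.QuantumAdvantage.Theorems.LocusDial.FewLocus m r P → ((Finset.univ.filter fun x : Fin n → Bool => Summit.QuantumAdvantage.AdviceFreeQNC0.OddZeros x ∧ Literature.Computability.QuantumComplexity.RingHLF.Rel x (fun i => decide (P i x = 1))).card : ℝ) ≤ (1 - 1 / (n : ℝ) ^ C) * (2 : ℝ) ^ (n - 1)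

/-- item stmt-QuantumAdvantage-27138 · crux · RESIDUAL (gen 0; summit-strength until shown otherwise, D-0170) · leaf IDEA-NEEDED · rank 3 · open
reduced to route-QuantumAdvantage-SparsityDial: CounterLoss3, NonCounterGenericLoss3, CounterLoss32, AbelianLoss3, NonAbelianLoss3, SparseGenericLoss3, DenseGenericLoss3 · residual NonCounterGenericLoss3
refined by: route-QuantumAdvantage-SparsityDial [split, draft] · by planner
why it might fail: a «dark» win-preserving XOR map w (low degree, w(x) ∈ Im M(x) a.e., quotient M(x)⁺w NOT polylog-degree) would move near-perfect structured strategies into the generic class, so G carries all of T with no reduction; null-answer rigidity is only instrument-checked (n ≤ 12).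
sources: BravyiGossetKonig2018, arXiv:1906.08890, Smolensky1987, BarringtonStraubingTherien1990
[crux] G — the GENERIC piece (declared RESIDUAL of this cut; leaf IDEA-NEEDED; text = the landed
`Theorems.StabilizerDial.StabGenericLossPos3` verbatim): for some C, for all m, r, c, eventually in
n, every 𝔽₃ strategy of output degree (log₂ n)^c that NO stabilizer gauge s of degree (log₂ n)^(c+1)
turns into an (m+1, r)-few-locus strategy (¬ StabFew (m+1) r (c+1) P) wins at most (1 −
n^(−C))·2^(n−1) odd inputs. T-implied by restriction; ≡ T modulo U like every complement piece
(`nodePos_iff`), but padding-closed by theorem and with a certified non-empty class at every (m+1,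
r, c ≥ 1) (`antipodal_class_nonempty`). [difficulty: open-problem] -/
@[route_item "route-QuantumAdvantage-StabilizerDial", crux (bottleneck := idea) (source := "ledger wanted_by.residual on stmt-QuantumAdvantage-27138, 2026-09-01")]
def StabGenericLossPos3 : Prop :=
  ∃ C : ℕ, ∀ m r c : ℕ, ∃ n₀ : ℕ, ∀ n ≥ n₀, ∀ P : Fin n → Literature.Computability.MetaComplexity.Smolensky.CubeFn (ZMod 3) n, (∀ i, P i ∈ Literature.Computability.MetaComplexity.Smolensky.lowDeg (ZMod 3) n ((Nat.log 2 n) ^ c)) → ¬ Summit.QuantumAdvantage.QuantumAdvantage.Theorems.StabilizerDial.StabFew (m + 1) r (c + 1) P → ((Finset.univ.filter fun x : Fin n → Bool => Summit.QuantumAdvantage.AdviceFreeQNC0.OddZeros x ∧ Literature.Computability.QuantumComplexity.RingHLF.Rel x (fun i => decide (P i x = 1))).card : ℝ) ≤ (1 - 1 / (n : ℝ) ^ C) * (2 : ℝ) ^ (n - 1)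

/-- item stmt-QuantumAdvantage-27139 · support · rank 9 · closed · proved by Summit.QuantumAdvantage.QuantumAdvantage.Theorems.stabilizerDial_stabSplitGlue3 (prover) · by planner
sources: BravyiGossetKonig2018
[support] the split glue: U and G give the parent item 26531 (dichotomy at budget c on `StabFew
(c+1) c (c+1) P`: structured ⇒ U at (c+1, c, c+2) applied to the pad, win set unchanged by
`winset_pad`; generic ⇒ G at (c, c, c); C := max). A binder of `closes` so that the refined target
is in the cone BY NAME; inhabited NOW by the landed
`Theorems.StabilizerDial.polyLossOddU3_of_stabPos` (census-closable at birth). [difficulty: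
provable-now] -/
@[route_item "route-QuantumAdvantage-StabilizerDial", crux]
def StabSplitGlue3 : Prop :=
  FewLocusLoss3 → StabGenericLossPos3 → Summit.QuantumAdvantage.QuantumAdvantage.Theses.ExactnessDial.PolyLossOddU3

-- `StabSplitGlue3` holds: proved by `Summit.QuantumAdvantage.QuantumAdvantage.Theorems.stabilizerDial_stabSplitGlue3` (its module imports this route file, so no `_holds` link can be stated here).

/-- item stmt-QuantumAdvantage-27140 · assembly · rank 1 · closed · proved by Summit.QuantumAdvantage.QuantumAdvantage.Theorems.stabilizerDial_assembly (prover) · by planner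
sources: BravyiGossetKonig2018
[assembly] FewLocusLoss3 → StabGenericLossPos3 → StabSplitGlue3 → ExactnessDial.PolyLossOddU3 (the
junction 26531 by name; the parent residual HolonomyDial.AvoidLift3 ⟺ it). -/
@[route_item "route-QuantumAdvantage-StabilizerDial"]
def Assembly : Prop :=
  FewLocusLoss3 → StabGenericLossPos3 → StabSplitGlue3 → Summit.QuantumAdvantage.QuantumAdvantage.Theses.ExactnessDial.PolyLossOddU3

-- `Assembly` holds: proved by `Summit.QuantumAdvantage.QuantumAdvantage.Theorems.stabilizerDial_assembly` (its module imports this route file, so no `_holds` link can be stated here).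

/-! D-0027 §2.1 — DECIDING THEOREM (planner-authored via `route open/edit --closes-file`; by planner-decomp-qadv-writer-1-g7-0 2026-08-30T23:57:54Z):
its hypotheses are this route's items and its conclusion the registered leaf `Summit.QuantumAdvantage.QuantumAdvantage.Theses.HolonomyDial.AvoidLift3` (rung None, D-0061) (glue_lint), and it elaborates with this file. -/

/-- Deciding theorem of the CHILD route StabilizerDial (D-0170 `refines route-QuantumAdvantage-HolonomyDial:AvoidLift3`; writer g7,
2026-08-30; lens-2 g17 node «StabilizerDial» rev 2 31f3d272 + landed parts StabilizerDialGauge/GaugeZ/Antipodal, critic row 69v21 CLEARED):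
the localisation piece U `FewLocusLoss3` (crux) and the gauge-generic piece G `StabGenericLossPos3` (declared residual) give the junction
`ExactnessDial.PolyLossOddU3` (26531) through the split glue g : StabSplitGlue3 (support — the proved dichotomy
`Theorems.StabilizerDial.polyLossOddU3_of_stabPos`, landed), hence the parent's declared residual `HolonomyDial.AvoidLift3` (34246 :=
HolAvoidLoss3 → PolyLossOddU3, ≡ 26531 by the landed `polyLossOddU3_iff_avoidLift3` since 34245 is proved) BY NAME. Binders consumed 3/3;
0 sorry. -/
@[closes "route-QuantumAdvantage-StabilizerDial"] theorem closes (hU : FewLocusLoss3) (hG : StabGenericLossPos3) (g : StabSplitGlue3) :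
    Summit.QuantumAdvantage.QuantumAdvantage.Theses.HolonomyDial.AvoidLift3 :=
  fun _ => g hU hG

end Summit.QuantumAdvantage.QuantumAdvantage.Theses.StabilizerDial
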